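import Summits.Ventures.GridStability.Models.AggregateFrequency

/-!
# GridStability/Models/AggregateFrequencyLossy — the droop-weighted mean frequency of the FULL droop+QV microgrid WITH transfer conductances: a certified funnel inside the voltage box (every `n`)

Cell `gridfusion` (LADDER-GRIDFUSION, apex line G3.b; seat gridfusion-model-3 (g8); STAGED next-wave companion of
`Models/AggregateFrequency.lean` (★★ «N1-AGG-FREQ», p536298) — there the reduced network is LOSSLESS (`G = 0`) and the
aggregate law is EXACT; here `G ≠ 0` (Kron-reduced constant-impedance loads, resistive lines) and the law becomes a
FUNNEL whose half-width is set by the conductances alone, valid inside the certified voltage box of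
`Models/DroopVoltageBox.lean` (★ #87, `voltage_wbox_invariant`).

Sources: [cite: KunduEtAl2019] (4a)–(4c), (5a) (the model, typed `DroopMicrogrid.field` p464230); [cite: ShinZavala2020]
§III-A before (9) («divide (8b) by `k_Pi` and sum») [corpus:paper:arxiv-2002.09802 p.4].

WHAT IS CERTIFIED (kernel; std axioms; 0 kit). `B` symmetric ⇒ the synchronising terms cancel in the sum of the
injections: `Σ_i P_i(θ, V) = Σ_i Σ_j V_i V_j G_ij cos θ_ij` (`sum_P_eq_of_symm`); inside the box `0 ≤ V_j ≤ λ w_j`: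
`|Σ_i P_i| ≤ Γ_G := λ² Σ_i Σ_j w_i w_j |G_ij|` (`abs_sum_P_le_of_box`). Under the hypotheses of `voltage_wbox_invariant`
(`τ_Qi > 0`, `λ^q_i ≥ 0`, `b_i > 0`, weighted susceptance dominance, `b_i < λ w_i`), a common active-power filter
constant `τ_Pi = τ > 0` and `λ^p_i ≠ 0`: along EVERY solution of the FULL model on `[0, T]` with voltages starting in the
box, the droop sum `S = Σ ω_i/λ^p_i` obeys `|S(t) − Σ P_i^set| ≤ Γ_G + |S(0) − Σ P_i^set| e^{−t/τ}`
(`abs_droopSum_sub_le_of_box`) — angles arbitrary.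

THREE COLUMNS. CERTIFIED: the inequalities. MODELLED: (4a)–(4c) bus-admittance form (MV-6N/V0), common filter constant;
AGGREGATE only (not a synchronisation statement); crude `Γ_G` (all `cos θ_ij` bounded by 1, self-conductance load terms
included). VALIDATED: nothing.
-/

noncomputable section

open Real Set Filter Finset Topology

namespace Summit.Ventures.GridStability.Models.DroopMicrogrid

variable {n : ℕ} (mg : DroopMicrogrid n)

/-- Conductance bound for the summed injections inside the weighted box: `Γ_G = λ² Σ_i Σ_j w_i w_j |G_ij|`. -/
def sumPBound (w : Fin n → ℝ) (lam : ℝ) : ℝ := lam ^ 2 * ∑ i, ∑ j, w i * w j * |mg.G i j|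

/-- `Γ_G ≥ 0` for nonnegative weights. -/
theorem sumPBound_nonneg {w : Fin n → ℝ} (hw : ∀ i, 0 ≤ w i) (lam : ℝ) : 0 ≤ mg.sumPBound w lam := by
  unfold sumPBound
  exact mul_nonneg (sq_nonneg _) (sum_nonneg fun i _ => sum_nonneg fun j _ =>
    mul_nonneg (mul_nonneg (hw i) (hw j)) (abs_nonneg _))

/-- For symmetric `B` the `B`-terms cancel in the summed injections:
`Σ_i P_i(θ, V) = Σ_i Σ_j V_i V_j G_ij cos(θ_i − θ_j)`. [cite: ShinZavala2020, §III-A before (9)] -/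
theorem sum_P_eq_of_symm (hB : ∀ i j, mg.B i j = mg.B j i) (θ V : Fin n → ℝ) :
    ∑ i, mg.P θ V i = ∑ i, ∑ j, V i * V j * (mg.G i j * cos (θ i - θ j)) := by
  have h : ∑ i, ∑ j, V i * V j * (mg.B i j * sin (θ i - θ j))
      = -∑ i, ∑ j, V i * V j * (mg.B i j * sin (θ i - θ j)) := by
    conv_lhs => rw [Finset.sum_comm]
    rw [← Finset.sum_neg_distrib]
    refine Finset.sum_congr rfl fun i _ => ?_
    rw [← Finset.sum_neg_distrib]
    refine Finset.sum_congr rfl fun j _ => ?_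
    rw [hB j i, ← neg_sub (θ i) (θ j), sin_neg]
    ring
  have h0 : ∑ i, ∑ j, V i * V j * (mg.B i j * sin (θ i - θ j)) = 0 := by linarith
  have hsplit : ∑ i, mg.P θ V i = ∑ i, ∑ j, V i * V j * (mg.G i j * cos (θ i - θ j))
      + ∑ i, ∑ j, V i * V j * (mg.B i j * sin (θ i - θ j)) := by
    rw [← Finset.sum_add_distrib]
    refine Finset.sum_congr rfl fun i _ => ?_
    rw [P, ← Finset.sum_add_distrib]
    exact Finset.sum_congr rfl fun j _ => by ring
  rw [hsplit, h0, add_zero]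

/-- Inside the box `0 ≤ V_j ≤ λ w_j` (nonnegative `λ`, `w`): `|Σ_i P_i(θ, V)| ≤ Γ_G`, all angles. -/
theorem abs_sum_P_le_of_box (hB : ∀ i j, mg.B i j = mg.B j i) (θ V : Fin n → ℝ) {w : Fin n → ℝ}
    {lam : ℝ} (hlam : 0 ≤ lam) (hw : ∀ j, 0 ≤ w j) (hbox : ∀ j, 0 ≤ V j ∧ V j ≤ lam * w j) :
    |∑ i, mg.P θ V i| ≤ mg.sumPBound w lam := by
  rw [mg.sum_P_eq_of_symm hB, sumPBound, Finset.mul_sum]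
  refine (abs_sum_le_sum_abs _ _).trans (sum_le_sum fun i _ => ?_)
  rw [Finset.mul_sum]
  refine (abs_sum_le_sum_abs _ _).trans (sum_le_sum fun j _ => ?_)
  rw [abs_mul, abs_mul, abs_mul, abs_of_nonneg (hbox i).1, abs_of_nonneg (hbox j).1]
  have hc : |cos (θ i - θ j)| ≤ 1 := abs_cos_le_one _
  have hVV : V i * V j ≤ lam * w i * (lam * w j) :=
    mul_le_mul (hbox i).2 (hbox j).2 (hbox j).1 (mul_nonneg hlam (hw i))
  calc V i * V j * (|mg.G i j| * |cos (θ i - θ j)|)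
      ≤ lam * w i * (lam * w j) * (|mg.G i j| * 1) :=
        mul_le_mul hVV (mul_le_mul_of_nonneg_left hc (abs_nonneg _))
          (mul_nonneg (abs_nonneg _) (abs_nonneg _))
          (mul_nonneg (mul_nonneg hlam (hw i)) (mul_nonneg hlam (hw j)))
    _ = lam ^ 2 * (w i * w j * |mg.G i j|) := by ring

variable {mg}

/-- **Mean-frequency funnel for the FULL model WITH transfer conductances (every `n`).** Under the voltage-box
hypotheses of `voltage_wbox_invariant`, `B` symmetric, a common filter constant `τ_Pi = τ > 0` and `λ^p_i ≠ 0`: along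
every solution on `[0, T]` with voltages starting in the box, for every `t ∈ [0, T]`,
`S(t) − (ΣP^set + Γ_G) ≤ (S(0) − (ΣP^set + Γ_G)) e^{−t/τ}` and `(S(0) − (ΣP^set − Γ_G)) e^{−t/τ} ≤ S(t) − (ΣP^set − Γ_G)`. -/
theorem droopSum_funnel_of_box (hτQ : ∀ i, 0 < mg.τQ i) (hkQ : ∀ i, 0 ≤ mg.kQ i)
    (hb : ∀ i, 0 < mg.Vset i + mg.kQ i * mg.Qset i)
    {w : Fin n → ℝ} (hw : ∀ i, 0 < w i)
    (hdom : ∀ i, ∑ j ∈ univ.erase i, (|mg.G i j| + |mg.B i j|) * w j ≤ -mg.B i i * w i)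
    {lam : ℝ} (hlam : ∀ i, mg.Vset i + mg.kQ i * mg.Qset i < lam * w i)
    (hB : ∀ i j, mg.B i j = mg.B j i) (hk : ∀ i, mg.kP i ≠ 0) {τ : ℝ} (hτ : ∀ i, mg.τP i = τ) (hτpos : 0 < τ)
    {T : ℝ} {γ : ℝ → State n} (h : mg.IsSolutionOn γ (Icc 0 T))
    (h0 : ∀ i, 0 ≤ (γ 0).2.2 i ∧ (γ 0).2.2 i ≤ lam * w i) {t : ℝ} (ht : t ∈ Icc 0 T) :
    mg.droopSum (γ t).2.1 - (∑ i, mg.Pset i + mg.sumPBound w lam)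
        ≤ (mg.droopSum (γ 0).2.1 - (∑ i, mg.Pset i + mg.sumPBound w lam)) * exp (-(t / τ)) ∧
      (mg.droopSum (γ 0).2.1 - (∑ i, mg.Pset i - mg.sumPBound w lam)) * exp (-(t / τ))
        ≤ mg.droopSum (γ t).2.1 - (∑ i, mg.Pset i - mg.sumPBound w lam) := by
  have hbox := mg.voltage_wbox_invariant hτQ hkQ hb hw hdom hlam h h0
  -- the drive bound |Σ P| ≤ Γ_G along the solution (vacuous when there are no nodes)
  have hdrive : ∀ s ∈ Icc 0 T, |∑ i, mg.P (γ s).1 (γ s).2.2 i| ≤ mg.sumPBound w lam := by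
    intro s hs
    rcases isEmpty_or_nonempty (Fin n) with hn | ⟨⟨i⟩⟩
    · simp [sumPBound]
    · have hlam0 : 0 ≤ lam := by
        by_contra hneg
        have := mul_neg_of_neg_of_pos (not_le.mp hneg) (hw i)
        linarith [hb i, hlam i]
      exact mg.abs_sum_P_le_of_box hB _ _ hlam0 (fun j => (hw j).le) (hbox s hs)
  have hder := fun s (hs : s ∈ Icc 0 T) => hasDerivWithinAt_droopSum hk hτ h hs
  have hτinv : 0 ≤ τ⁻¹ := inv_nonneg.mpr hτpos.le
  have hct : τ⁻¹ * t = t / τ := by rw [div_eq_inv_mul]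
  set Γ := mg.sumPBound w lam
  set Ps := ∑ i, mg.Pset i
  constructor
  · have hmain := AggregateFrequency.sub_le_mul_exp (c := τ⁻¹) (K := Ps + Γ) hder (fun s hs => ?_) ht
    · rwa [hct] at hmain
    · have hd := (abs_le.mp (hdrive s hs)).1
      rw [div_eq_inv_mul]
      exact mul_le_mul_of_nonneg_left (by linarith) hτinv
  · have hmain := AggregateFrequency.mul_exp_le_sub (c := τ⁻¹) (K := Ps - Γ) hder (fun s hs => ?_) ht
    · rwa [hct] at hmain
    · have hd := (abs_le.mp (hdrive s hs)).2
      rw [div_eq_inv_mul]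
      exact mul_le_mul_of_nonneg_left (by linarith) hτinv

/-- **Absolute form.** Same hypotheses: `|S(t) − Σ P_i^set| ≤ Γ_G + |S(0) − Σ P_i^set| e^{−t/τ}` on `[0, T]` — the droop
sum (hence the droop-weighted mean frequency, after dividing by `Σ 1/λ^p_i`) enters and stays in the band of
half-width `Γ_G` around the lossless synchronised value, at the filter rate, angles arbitrary. -/
theorem abs_droopSum_sub_le_of_box (hτQ : ∀ i, 0 < mg.τQ i) (hkQ : ∀ i, 0 ≤ mg.kQ i)
    (hb : ∀ i, 0 < mg.Vset i + mg.kQ i * mg.Qset i)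
    {w : Fin n → ℝ} (hw : ∀ i, 0 < w i)
    (hdom : ∀ i, ∑ j ∈ univ.erase i, (|mg.G i j| + |mg.B i j|) * w j ≤ -mg.B i i * w i)
    {lam : ℝ} (hlam : ∀ i, mg.Vset i + mg.kQ i * mg.Qset i < lam * w i)
    (hB : ∀ i j, mg.B i j = mg.B j i) (hk : ∀ i, mg.kP i ≠ 0) {τ : ℝ} (hτ : ∀ i, mg.τP i = τ) (hτpos : 0 < τ)
    {T : ℝ} {γ : ℝ → State n} (h : mg.IsSolutionOn γ (Icc 0 T))
    (h0 : ∀ i, 0 ≤ (γ 0).2.2 i ∧ (γ 0).2.2 i ≤ lam * w i) {t : ℝ} (ht : t ∈ Icc 0 T) :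
    |mg.droopSum (γ t).2.1 - ∑ i, mg.Pset i|
      ≤ mg.sumPBound w lam + |mg.droopSum (γ 0).2.1 - ∑ i, mg.Pset i| * exp (-(t / τ)) := by
  obtain ⟨hu, hl⟩ := droopSum_funnel_of_box hτQ hkQ hb hw hdom hlam hB hk hτ hτpos h h0 ht
  have hΓ : 0 ≤ mg.sumPBound w lam := mg.sumPBound_nonneg (fun i => (hw i).le) lam
  have he : 0 < exp (-(t / τ)) := exp_pos _
  have h0a := le_abs_self (mg.droopSum (γ 0).2.1 - ∑ i, mg.Pset i)
  have h0b := neg_abs_le (mg.droopSum (γ 0).2.1 - ∑ i, mg.Pset i)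
  rw [abs_le]
  constructor <;> nlinarith

end Summit.Ventures.GridStability.Models.DroopMicrogrid

end
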